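import Literature.Barriers.NavierStokesRegularity.ComplexNavierStokesBlowupSeries
import Mathlib.Combinatorics.Enumerative.Catalan.Basic
import Mathlib.Analysis.SpecificLimits.Basic
import Mathlib.Analysis.SpecialFunctions.Integrals.Basic
import Mathlib.MeasureTheory.Group.LIntegral
import HarnessLib

/-!
# Li–Sinai complex Navier–Stokes blow-up: finite energy for small times

Fourth file of the barrier entry `ComplexNavierStokesBlowup` (D-0021), companion of
`ComplexNavierStokesBlowupSeries.lean` (the power series (3) of D. Li, Ya. G. Sinai, J. Eur. Math.
Soc. 10 (2008) 267–313, §2, and the theorem that it solves (1) at all times). Li–Sinai write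
(§2, p. 270): "It follows from the results of [S2] that the series (3) converges for sufficiently
small `s` and gives a classical solution of (1)." For the data class of the previous file
(bounded, measurable, vanishing off `{a ≤ k₃, |k| ≤ R}`) this file PROVES the energy version of
that sentence by an elementary argument (ours; [S2] there is Ya. G. Sinai, *Diagrammatic approach
to the 3D Navier–Stokes system*, Russian Math. Surveys 60 (2005) 849–873, and the power-series
method itself is [S1], Ya. G. Sinai, J. Statist. Phys. 121 (2005), cf. the bibliography p. 313):

* `LiSinai.mode_norm_bounds`: `∫ ‖mode v₀ (q+1) (s, k)‖ dk ≤ α₁ γ^q C_q s^q` and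
  `‖mode v₀ (q+1) (s, k)‖ ≤ M₀ γ^q C_q s^q` for `s ≥ 0`, with `α₁ = M₀ vol B(0,R)`,
  `γ = 4 |R| α₁`, `C_q` the Catalan numbers — the Duhamel pairs are bounded in `L¹ × L¹`
  (Tonelli and translation invariance of Lebesgue measure) and `L^∞ × L¹`; the factor
  `|k| ≤ (q+1)|R|` coming from the supports `supp g_p ⊆ C + ⋯ + C` is exactly compensated by the
  time integral `∫₀ˢ σ^{q-1} dσ = s^q/q`, so the growth is geometric and not factorial;
* `LiSinai.seriesSolution_energy_lt_top`: `∫ |v(k,t)|² dk < ∞` for `t < t₀ = 1/(4γ+1)`, via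
  `∫ |v|² ≤ ‖v‖_∞ ‖v‖₁` and `C_q ≤ 4^q`;
* the named fact `LiSinaiSeriesEnergyInfinite` — the FIRST inference of §10 from Theorem 1
  alone ("This immediately implies that at `t` the energy is infinite"): some admissible datum
  has a series solution of infinite energy at some `t > 0` — and the PROVED implication
  `LiSinaiSeriesEnergyInfinite → LiSinaiCriticalEnergyBlowupNarrow` (the Theorem-1-backed core
  of the audit in `ComplexNavierStokesBlowupProofs.lean`): the initial interval of finite energy
  demanded there is supplied by `seriesSolution_energy_lt_top`, equation (1) on `[0, t]` by
  `seriesSolution_solvesFourierNSAt`. Together with the proved dichotomy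
  `LiSinaiCriticalEnergyBlowupNarrow.literal_or_rightAccumulation` this pins down what the
  informal "for `t' < t` … finite" of §10 adds to Theorem 1 for the catalogue fact.

## What is NOT here

Any lower bound on the modes (Theorem 1); uniformity of `t₀` in the amplitude beyond the
explicit `t₀ = 1/(4γ+1)`; the classical (pointwise-decay) sense of "classical solution" in [S2].

## References

* D. Li, Ya. G. Sinai, J. Eur. Math. Soc. 10 (2008) 267–313, §2 p. 269–270, Thm. 1 p. 311,
  §10 p. 312. [`LiSinai2008`]
-/

noncomputable section

open MeasureTheory Set Filter Topology Finset
open scoped ENNReal InnerProductSpace RealInnerProductSpace BigOperators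

namespace Literature.Barriers.NavierStokesRegularity

/-- Local notation for Fourier space `ℝ³ = EuclideanSpace ℝ (Fin 3)`; `k 2` is the third
coordinate `k₃`. -/
local notation "ℝ³" => EuclideanSpace ℝ (Fin 3)

namespace LiSinai

open Literature.Analysis.FluidPDE (leraySymbol leraySymbol_apply)

/-! ### Small-time finiteness of the energy: `L¹`/`L^∞` bounds of the modes -/

/-- `∫⁻_{(0,t]} s^n ds = t^{n+1}/(n+1)` in `ℝ≥0∞`, `t ≥ 0`. [folklore] -/
theorem lintegral_Ioc_pow {t : ℝ} (ht : 0 ≤ t) (n : ℕ) :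
    ∫⁻ s in Ioc 0 t, ENNReal.ofReal (s ^ n) = ENNReal.ofReal (t ^ (n + 1) / (n + 1)) := by
  have hint : IntegrableOn (fun s : ℝ => s ^ n) (Ioc 0 t) volume :=
    (continuous_pow n).integrableOn_Icc.mono_set Ioc_subset_Icc_self
  rw [← ofReal_integral_eq_lintegral_ofReal hint]
  · congr 1
    rw [← intervalIntegral.integral_of_le ht, integral_pow]
    simp
  · exact (ae_restrict_of_forall_mem measurableSet_Ioc) fun s hs => pow_nonneg hs.1.le n

/-- `∫⁻_{(0,t]} (A s^i)(B s^j) ds = A B t^{n+1}/(n+1)` for `A, B, t ≥ 0`, `i + j = n`. [folklore] -/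
theorem lintegral_Ioc_pow_mul_pow {t A B : ℝ} (ht : 0 ≤ t) (hA : 0 ≤ A) (hB : 0 ≤ B) {i j n : ℕ}
    (hn : i + j = n) :
    ∫⁻ s in Ioc 0 t, ENNReal.ofReal (A * s ^ i) * ENNReal.ofReal (B * s ^ j) =
      ENNReal.ofReal (A * B * (t ^ (n + 1) / ((n : ℝ) + 1))) := by
  have h : ∀ s ∈ Ioc (0 : ℝ) t, ENNReal.ofReal (A * s ^ i) * ENNReal.ofReal (B * s ^ j) =
      ENNReal.ofReal (A * B) * ENNReal.ofReal (s ^ n) := by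
    intro s hs
    have hs0 : 0 ≤ s := hs.1.le
    rw [← ENNReal.ofReal_mul (by positivity), ← ENNReal.ofReal_mul (by positivity), ← hn]
    congr 1; ring
  rw [setLIntegral_congr_fun measurableSet_Ioc h, lintegral_const_mul' _ _ ENNReal.ofReal_ne_top,
    lintegral_Ioc_pow ht, ← ENNReal.ofReal_mul (by positivity)]

/-- Pointwise `ℝ≥0∞` bound for the interaction integrand: `‖⟨F,k⟩ P_k G‖ₑ ≤ |k| · 2 · ‖F‖ₑ ‖G‖ₑ`.
[folklore] -/
theorem enorm_pairIntegrand_le (F G : ℝ → ℝ³ → ℝ³) (k : ℝ³) (s : ℝ) (k' : ℝ³) :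
    ‖pairIntegrand F G k s k'‖ₑ ≤ ‖k‖ₑ * (2 * (‖F s (k - k')‖ₑ * ‖G s k'‖ₑ)) := by
  have h : ‖pairIntegrand F G k s k'‖ ≤ ‖k‖ * (2 * (‖F s (k - k')‖ * ‖G s k'‖)) := by
    unfold pairIntegrand
    rw [norm_smul, Real.norm_eq_abs]
    calc |⟪F s (k - k'), k⟫| * ‖leraySymbol k (G s k')‖
        ≤ (‖F s (k - k')‖ * ‖k‖) * (2 * ‖G s k'‖) :=
          mul_le_mul (abs_real_inner_le_norm _ _) (norm_leraySymbol_apply_le_two_mul _ _)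
            (norm_nonneg _) (by positivity)
      _ = ‖k‖ * (2 * (‖F s (k - k')‖ * ‖G s k'‖)) := by ring
  rw [← ofReal_norm, ← ofReal_norm, ← ofReal_norm, ← ofReal_norm]
  calc ENNReal.ofReal ‖pairIntegrand F G k s k'‖
      ≤ ENNReal.ofReal (‖k‖ * (2 * (‖F s (k - k')‖ * ‖G s k'‖))) := ENNReal.ofReal_le_ofReal h
    _ = ENNReal.ofReal ‖k‖ * (2 * (ENNReal.ofReal ‖F s (k - k')‖ * ENNReal.ofReal ‖G s k'‖)) := by
        rw [ENNReal.ofReal_mul (norm_nonneg _), ENNReal.ofReal_mul (by positivity),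
          ENNReal.ofReal_mul (norm_nonneg _), ENNReal.ofReal_ofNat]

/-- Support-aware bound: if `F(s,·)` vanishes off `{|k| ≤ Q}` and `G(s,·)` off `{|k| ≤ Q'}` then
`|k| · 2 · ‖F(s,k-k')‖ₑ ‖G(s,k')‖ₑ ≤ (Q + Q') · 2 · ‖F(s,k-k')‖ₑ ‖G(s,k')‖ₑ`. [folklore] -/
theorem enorm_mul_le_of_support {F G : ℝ → ℝ³ → ℝ³} {s : ℝ} {Q Q' : ℝ}
    (hF : ∀ k, F s k ≠ 0 → ‖k‖ ≤ Q) (hG : ∀ k, G s k ≠ 0 → ‖k‖ ≤ Q') (k k' : ℝ³) :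
    ‖k‖ₑ * (2 * (‖F s (k - k')‖ₑ * ‖G s k'‖ₑ)) ≤
      ENNReal.ofReal (Q + Q') * 2 * (‖F s (k - k')‖ₑ * ‖G s k'‖ₑ) := by
  by_cases hGz : G s k' = 0
  · simp [hGz]
  by_cases hFz : F s (k - k') = 0
  · simp [hFz]
  rw [mul_assoc]
  gcongr
  rw [← ofReal_norm]
  refine ENNReal.ofReal_le_ofReal ?_
  calc ‖k‖ = ‖(k - k') + k'‖ := by rw [sub_add_cancel]
    _ ≤ ‖k - k'‖ + ‖k'‖ := norm_add_le _ _
    _ ≤ Q + Q' := add_le_add (hF _ hFz) (hG _ hGz)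

/-- `ℝ≥0∞` bound for a Duhamel pair: for `t ≥ 0`,
`‖duhamelPair F G t k‖ₑ ≤ ∫⁻_{s ∈ (0,t]} ∫⁻_{k'} |k| · 2 · ‖F(s,k-k')‖ₑ ‖G(s,k')‖ₑ` (the heat
factor is `≤ 1`; junk Bochner integrals are `0` and satisfy the bound too). [folklore] -/
theorem enorm_duhamelPair_le (F G : ℝ → ℝ³ → ℝ³) {t : ℝ} (ht : 0 ≤ t) (k : ℝ³) :
    ‖duhamelPair F G t k‖ₑ ≤
      ∫⁻ s in Ioc 0 t, ∫⁻ k', ‖k‖ₑ * (2 * (‖F s (k - k')‖ₑ * ‖G s k'‖ₑ)) := by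
  rw [duhamelPair, intervalIntegral.integral_of_le ht]
  refine (enorm_integral_le_lintegral_enorm _).trans ?_
  refine setLIntegral_mono' measurableSet_Ioc fun s hs => ?_
  rw [enorm_smul]
  have hexp : ‖Real.exp (-(t - s) * ‖k‖ ^ 2)‖ₑ ≤ 1 := by
    rw [← ofReal_norm, Real.norm_eq_abs, abs_of_pos (Real.exp_pos _), ← ENNReal.ofReal_one]
    refine ENNReal.ofReal_le_ofReal ?_
    rw [Real.exp_le_one_iff]
    nlinarith [hs.2, sq_nonneg ‖k‖]
  calc ‖Real.exp (-(t - s) * ‖k‖ ^ 2)‖ₑ * ‖∫ k', pairIntegrand F G k s k'‖ₑ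
      ≤ 1 * ∫⁻ k', ‖pairIntegrand F G k s k'‖ₑ :=
        mul_le_mul' hexp (enorm_integral_le_lintegral_enorm _)
    _ ≤ ∫⁻ k', ‖k‖ₑ * (2 * (‖F s (k - k')‖ₑ * ‖G s k'‖ₑ)) := by
        rw [one_mul]; exact lintegral_mono fun k' => enorm_pairIntegrand_le F G k s k'

/-- Measurability of `((k, s), k') ↦ |k| · 2 · ‖F(s, k - k')‖ₑ ‖G(s, k')‖ₑ`. [folklore] -/
theorem measurable_enorm_conv {F G : ℝ → ℝ³ → ℝ³} (hF : Measurable (Function.uncurry F))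
    (hG : Measurable (Function.uncurry G)) :
    Measurable fun z : (ℝ³ × ℝ) × ℝ³ =>
      ‖z.1.1‖ₑ * (2 * (‖F z.1.2 (z.1.1 - z.2)‖ₑ * ‖G z.1.2 z.2‖ₑ)) := by
  have h1 : Measurable fun z : (ℝ³ × ℝ) × ℝ³ => F z.1.2 (z.1.1 - z.2) :=
    Measurable.comp hF (show Measurable fun z : (ℝ³ × ℝ) × ℝ³ => (z.1.2, z.1.1 - z.2) by fun_prop)
  have h2 : Measurable fun z : (ℝ³ × ℝ) × ℝ³ => G z.1.2 z.2 :=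
    Measurable.comp hG (show Measurable fun z : (ℝ³ × ℝ) × ℝ³ => (z.1.2, z.2) by fun_prop)
  exact measurable_fst.fst.enorm.mul (measurable_const.mul (h1.enorm.mul h2.enorm))

/-- Measurability of the time slices of a jointly measurable field. [folklore] -/
theorem measurable_slice {F : ℝ → ℝ³ → ℝ³} (hF : Measurable (Function.uncurry F)) (s : ℝ) :
    Measurable (F s) :=
  hF.comp (measurable_const.prodMk measurable_id)

/-- The convolution identity `∫⁻∫⁻ ‖F(s,k-k')‖ₑ ‖G(s,k')‖ₑ dk' dk = ‖F(s)‖₁ ‖G(s)‖₁` (Tonelli and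
translation invariance of Lebesgue measure on `ℝ³`). [folklore] -/
theorem lintegral_lintegral_enorm_sub_mul {F G : ℝ → ℝ³ → ℝ³} (hF : Measurable (Function.uncurry F))
    (hG : Measurable (Function.uncurry G)) (s : ℝ) :
    ∫⁻ k, ∫⁻ k', ‖F s (k - k')‖ₑ * ‖G s k'‖ₑ = (∫⁻ k, ‖F s k‖ₑ) * ∫⁻ k', ‖G s k'‖ₑ := by
  have hFs : Measurable (F s) := measurable_slice hF s
  have hGs : Measurable (G s) := measurable_slice hG s
  have hmeas : Measurable (Function.uncurry fun k k' : ℝ³ => ‖F s (k - k')‖ₑ * ‖G s k'‖ₑ) := by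
    have h1 : Measurable fun z : ℝ³ × ℝ³ => F s (z.1 - z.2) :=
      hFs.comp (measurable_fst.sub measurable_snd)
    exact h1.enorm.mul (hGs.comp measurable_snd).enorm
  rw [lintegral_lintegral_swap hmeas.aemeasurable]
  have hinner : ∀ k', ∫⁻ k, ‖F s (k - k')‖ₑ * ‖G s k'‖ₑ = (∫⁻ k, ‖F s k‖ₑ) * ‖G s k'‖ₑ := by
    intro k'
    rw [lintegral_mul_const' _ _ enorm_ne_top]
    congr 1
    exact lintegral_sub_right_eq_self (fun k => ‖F s k‖ₑ) k'
  simp_rw [hinner]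
  rw [lintegral_const_mul _ hGs.enorm]

/-- **`L¹` bound for a Duhamel pair.** If on `[0, T]` the fields `F, G` are supported in
`{|k| ≤ Q}`, `{|k| ≤ Q'}` respectively, then for `t ∈ [0, T]`
`∫ ‖duhamelPair F G t k‖ dk ≤ (Q+Q') · 2 · ∫_{(0,t]} ‖F(s)‖₁ ‖G(s)‖₁ ds` (Tonelli, the support
bound `|k| ≤ Q + Q'`, the convolution identity). [folklore] -/
theorem lintegral_enorm_duhamelPair_le {F G : ℝ → ℝ³ → ℝ³} {T Q Q' : ℝ}
    (hFm : Measurable (Function.uncurry F)) (hGm : Measurable (Function.uncurry G))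
    (hF : ∀ s ∈ Icc 0 T, ∀ k, F s k ≠ 0 → ‖k‖ ≤ Q) (hG : ∀ s ∈ Icc 0 T, ∀ k, G s k ≠ 0 → ‖k‖ ≤ Q')
    {t : ℝ} (ht : t ∈ Icc 0 T) :
    ∫⁻ k, ‖duhamelPair F G t k‖ₑ ≤ ENNReal.ofReal (Q + Q') * 2 *
      ∫⁻ s in Ioc 0 t, (∫⁻ k, ‖F s k‖ₑ) * ∫⁻ k', ‖G s k'‖ₑ := by
  set C : ℝ≥0∞ := ENNReal.ofReal (Q + Q') * 2 with hC
  have hCtop : C ≠ ∞ := ENNReal.mul_ne_top ENNReal.ofReal_ne_top ENNReal.ofNat_ne_top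
  calc ∫⁻ k, ‖duhamelPair F G t k‖ₑ
      ≤ ∫⁻ k, ∫⁻ s in Ioc 0 t, ∫⁻ k', ‖k‖ₑ * (2 * (‖F s (k - k')‖ₑ * ‖G s k'‖ₑ)) :=
        lintegral_mono fun k => enorm_duhamelPair_le F G ht.1 k
    _ = ∫⁻ s in Ioc 0 t, ∫⁻ k, ∫⁻ k', ‖k‖ₑ * (2 * (‖F s (k - k')‖ₑ * ‖G s k'‖ₑ)) := by
        refine lintegral_lintegral_swap ?_
        exact ((measurable_enorm_conv hFm hGm).lintegral_prod_right').aemeasurable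
    _ ≤ ∫⁻ s in Ioc 0 t, ∫⁻ k, ∫⁻ k', C * (‖F s (k - k')‖ₑ * ‖G s k'‖ₑ) := by
        refine setLIntegral_mono' measurableSet_Ioc fun s hs => ?_
        have hsT : s ∈ Icc 0 T := ⟨hs.1.le, hs.2.trans ht.2⟩
        exact lintegral_mono fun k => lintegral_mono fun k' =>
          enorm_mul_le_of_support (hF s hsT) (hG s hsT) k k'
    _ = ∫⁻ s in Ioc 0 t, C * ((∫⁻ k, ‖F s k‖ₑ) * ∫⁻ k', ‖G s k'‖ₑ) := by
        refine setLIntegral_congr_fun measurableSet_Ioc fun s _ => ?_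
        rw [← lintegral_lintegral_enorm_sub_mul hFm hGm s, ← lintegral_const_mul' C _ hCtop]
        exact lintegral_congr fun k => lintegral_const_mul' C _ hCtop
    _ = C * ∫⁻ s in Ioc 0 t, (∫⁻ k, ‖F s k‖ₑ) * ∫⁻ k', ‖G s k'‖ₑ :=
        lintegral_const_mul' C _ hCtop

/-- **Sup bound for a Duhamel pair** in `L^∞ × L¹` form: with the same support hypotheses and a
pointwise bound `‖F(s, ·)‖ₑ ≤ B(s)`, for `t ∈ [0, T]` and every `k`,
`‖duhamelPair F G t k‖ₑ ≤ (Q+Q') · 2 · ∫_{(0,t]} B(s) ‖G(s)‖₁ ds`. [folklore] -/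
theorem enorm_duhamelPair_le_sup {F G : ℝ → ℝ³ → ℝ³} {T Q Q' : ℝ} {B : ℝ → ℝ≥0∞}
    (hGm : Measurable (Function.uncurry G))
    (hF : ∀ s ∈ Icc 0 T, ∀ k, F s k ≠ 0 → ‖k‖ ≤ Q) (hG : ∀ s ∈ Icc 0 T, ∀ k, G s k ≠ 0 → ‖k‖ ≤ Q')
    (hB : ∀ s ∈ Icc 0 T, ∀ k, ‖F s k‖ₑ ≤ B s) {t : ℝ} (ht : t ∈ Icc 0 T) (k : ℝ³) :
    ‖duhamelPair F G t k‖ₑ ≤ ENNReal.ofReal (Q + Q') * 2 *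
      ∫⁻ s in Ioc 0 t, B s * ∫⁻ k', ‖G s k'‖ₑ := by
  set C : ℝ≥0∞ := ENNReal.ofReal (Q + Q') * 2 with hC
  have hCtop : C ≠ ∞ := ENNReal.mul_ne_top ENNReal.ofReal_ne_top ENNReal.ofNat_ne_top
  calc ‖duhamelPair F G t k‖ₑ
      ≤ ∫⁻ s in Ioc 0 t, ∫⁻ k', ‖k‖ₑ * (2 * (‖F s (k - k')‖ₑ * ‖G s k'‖ₑ)) :=
        enorm_duhamelPair_le F G ht.1 k
    _ ≤ ∫⁻ s in Ioc 0 t, ∫⁻ k', C * (B s * ‖G s k'‖ₑ) := by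
        refine setLIntegral_mono' measurableSet_Ioc fun s hs => lintegral_mono fun k' => ?_
        have hsT : s ∈ Icc 0 T := ⟨hs.1.le, hs.2.trans ht.2⟩
        refine (enorm_mul_le_of_support (hF s hsT) (hG s hsT) k k').trans ?_
        gcongr
        exact hB s hsT _
    _ = C * ∫⁻ s in Ioc 0 t, B s * ∫⁻ k', ‖G s k'‖ₑ := by
        rw [← lintegral_const_mul' C _ hCtop]
        refine setLIntegral_congr_fun measurableSet_Ioc fun s _ => ?_
        rw [lintegral_const_mul' C _ hCtop,
          lintegral_const_mul'' (B s) (measurable_slice hGm s).enorm.aemeasurable]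

/-- `volume B(0, ρ) = ofReal (ballVol ρ)` in Fourier space. [folklore] -/
theorem volume_closedBall_eq_ofReal_ballVol (ρ : ℝ) :
    volume (Metric.closedBall (0 : ℝ³) ρ) = ENNReal.ofReal (ballVol ρ) := by
  rw [ballVol, measureReal_def, ENNReal.ofReal_toReal measure_closedBall_lt_top.ne]

/-- Sup bound for the first mode: `‖e^{-s|k|²} v₀ k‖ ≤ M₀` for `s ≥ 0`. [folklore] -/
theorem enorm_mode_one_le {v₀ : ℝ³ → ℝ³} {M₀ : ℝ} (hM₀ : ∀ k, ‖v₀ k‖ ≤ M₀) {s : ℝ} (hs : 0 ≤ s)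
    (k : ℝ³) : ‖mode v₀ 1 s k‖ₑ ≤ ENNReal.ofReal M₀ := by
  rw [← ofReal_norm]
  refine ENNReal.ofReal_le_ofReal ?_
  rw [mode_one, norm_smul, Real.norm_eq_abs, abs_of_pos (Real.exp_pos _)]
  have hexp : Real.exp (-s * ‖k‖ ^ 2) ≤ 1 := by
    rw [Real.exp_le_one_iff]; nlinarith [sq_nonneg ‖k‖]
  calc Real.exp (-s * ‖k‖ ^ 2) * ‖v₀ k‖ ≤ 1 * M₀ :=
        mul_le_mul hexp (hM₀ k) (norm_nonneg _) zero_le_one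
    _ = M₀ := one_mul _

/-- `L¹` bound for the first mode: `∫ ‖e^{-s|k|²} v₀ k‖ dk ≤ M₀ · vol B(0, R)` for `s ≥ 0` and a
datum bounded by `M₀` vanishing off `{|k| ≤ R}`. [folklore] -/
theorem lintegral_enorm_mode_one_le {v₀ : ℝ³ → ℝ³} {a R M₀ : ℝ}
    (hv₀ : ∀ k, v₀ k ≠ 0 → a ≤ k 2 ∧ ‖k‖ ≤ R) (hM₀ : ∀ k, ‖v₀ k‖ ≤ M₀) {s : ℝ} (hs : 0 ≤ s) :
    ∫⁻ k, ‖mode v₀ 1 s k‖ₑ ≤ ENNReal.ofReal (M₀ * ballVol R) := by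
  have hM₀' : 0 ≤ M₀ := (norm_nonneg _).trans (hM₀ 0)
  have hpt : ∀ k, ‖mode v₀ 1 s k‖ₑ ≤
      (Metric.closedBall (0 : ℝ³) R).indicator (fun _ => ENNReal.ofReal M₀) k := by
    intro k
    by_cases hk : v₀ k = 0
    · simp [mode_one, hk]
    · rw [Set.indicator_of_mem (mem_closedBall_zero_iff.2 (hv₀ k hk).2)]
      exact enorm_mode_one_le hM₀ hs k
  calc ∫⁻ k, ‖mode v₀ 1 s k‖ₑ
      ≤ ∫⁻ k, (Metric.closedBall (0 : ℝ³) R).indicator (fun _ => ENNReal.ofReal M₀) k :=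
        lintegral_mono hpt
    _ = ENNReal.ofReal M₀ * volume (Metric.closedBall (0 : ℝ³) R) :=
        lintegral_indicator_const measurableSet_closedBall _
    _ = ENNReal.ofReal (M₀ * ballVol R) := by
        rw [volume_closedBall_eq_ofReal_ballVol, ← ENNReal.ofReal_mul hM₀']

/-- The elementary inequality behind the geometric growth of the bounds:
`(m+2) · 2 X / (m+1) ≤ 4 X` for `X ≥ 0`. [folklore] -/
theorem key_ratio_le (m : ℕ) {X : ℝ} (hX : 0 ≤ X) :
    ((m + 2 : ℕ) : ℝ) * 2 * X / ((m : ℝ) + 1) ≤ 4 * X := by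
  rw [div_le_iff₀ (by positivity)]
  push_cast
  nlinarith


/-- Norm supports of the modes in the form used by the pair bounds: `mode v₀ (q+1) (s, ·)`
vanishes off `{|k| ≤ (q+1) |R|}`. [cite: LiSinai2008, §2 p. 270] -/
theorem mode_support_norm {v₀ : ℝ³ → ℝ³} {a R : ℝ} (hv₀ : ∀ k, v₀ k ≠ 0 → a ≤ k 2 ∧ ‖k‖ ≤ R)
    (q : ℕ) (s : ℝ) (k : ℝ³) (hk : mode v₀ (q + 1) s k ≠ 0) : ‖k‖ ≤ ((q + 1 : ℕ) : ℝ) * |R| :=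
  (mode_support hv₀ (q + 1) s k hk).2.trans
    (mul_le_mul_of_nonneg_left (le_abs_self R) (by positivity))

/-- **Geometric `L¹` and sup bounds for the modes** (the estimate behind "the series (3)
converges for sufficiently small `s`", §2 p. 270, here for bounded data supported in
`{a ≤ k₃, |k| ≤ R}`): with `α₁ = M₀ · vol B(0,R)` and `γ = 4|R| α₁`, for every `q` and `s ≥ 0`,
`∫ ‖mode v₀ (q+1) (s,k)‖ dk ≤ α₁ γ^q C_q s^q` and `‖mode v₀ (q+1) (s,k)‖ ≤ M₀ γ^q C_q s^q`,
`C_q` the Catalan numbers. Proof: strong induction on `q`; the Duhamel pairs are estimated in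
`L¹ × L¹` (Tonelli, translation invariance) and `L^∞ × L¹`, the factor `|k| ≤ (q+1)|R|` from the
supports is compensated by `∫₀ˢ σ^{q-1} dσ = s^q / q`, and the Catalan recursion closes the
induction. [folklore] -/
theorem mode_norm_bounds {v₀ : ℝ³ → ℝ³} {a R M₀ : ℝ} (hv₀m : Measurable v₀)
    (hv₀ : ∀ k, v₀ k ≠ 0 → a ≤ k 2 ∧ ‖k‖ ≤ R) (hM₀ : ∀ k, ‖v₀ k‖ ≤ M₀) :
    ∀ q : ℕ, ∀ s : ℝ, 0 ≤ s →
      (∫⁻ k, ‖mode v₀ (q + 1) s k‖ₑ ≤ ENNReal.ofReal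
          (M₀ * ballVol R * (4 * |R| * (M₀ * ballVol R)) ^ q * catalan q * s ^ q)) ∧
      ∀ k, ‖mode v₀ (q + 1) s k‖ₑ ≤ ENNReal.ofReal
          (M₀ * (4 * |R| * (M₀ * ballVol R)) ^ q * catalan q * s ^ q) := by
  have hM₀' : 0 ≤ M₀ := (norm_nonneg _).trans (hM₀ 0)
  set α₁ : ℝ := M₀ * ballVol R with hα₁
  have hα₁0 : 0 ≤ α₁ := mul_nonneg hM₀' (ballVol_nonneg R)
  set γ : ℝ := 4 * |R| * α₁ with hγ
  have hγ0 : 0 ≤ γ := by positivity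
  have hmeas : ∀ p, Measurable (Function.uncurry (mode v₀ p)) := measurable_mode hv₀m
  have hsupp : ∀ (i : ℕ) (T : ℝ) (σ : ℝ), σ ∈ Icc 0 T → ∀ k, mode v₀ (i + 1) σ k ≠ 0 →
      ‖k‖ ≤ ((i + 1 : ℕ) : ℝ) * |R| := fun i T σ _ k hk => mode_support_norm hv₀ i σ k hk
  intro q
  induction q using Nat.strong_induction_on with
  | _ q ih =>
  intro s hs
  rcases q with _ | m
  · refine ⟨?_, fun k => ?_⟩
    · simpa using lintegral_enorm_mode_one_le hv₀ hM₀ hs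
    · simpa using enorm_mode_one_le hM₀ hs k
  · have hst : s ∈ Icc 0 s := ⟨hs, le_rfl⟩
    -- the real bounds for the `i`-th Duhamel pair, `L¹` and sup versions
    have hpair : ∀ i : Fin (m + 1),
        (∫⁻ k, ‖duhamelPair (mode v₀ (i.1 + 1)) (mode v₀ (m - i.1 + 1)) s k‖ₑ ≤
          ENNReal.ofReal (((m + 2 : ℕ) : ℝ) * |R| * 2 *
            (α₁ * γ ^ i.1 * catalan i.1 * (α₁ * γ ^ (m - i.1) * catalan (m - i.1)) *
              (s ^ (m + 1) / ((m : ℝ) + 1))))) ∧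
        ∀ k, ‖duhamelPair (mode v₀ (i.1 + 1)) (mode v₀ (m - i.1 + 1)) s k‖ₑ ≤
          ENNReal.ofReal (((m + 2 : ℕ) : ℝ) * |R| * 2 *
            (M₀ * γ ^ i.1 * catalan i.1 * (α₁ * γ ^ (m - i.1) * catalan (m - i.1)) *
              (s ^ (m + 1) / ((m : ℝ) + 1)))) := by
      intro i
      have hi : i.1 ≤ m := Nat.lt_succ_iff.1 i.2
      have ihF := fun σ (hσ : 0 ≤ σ) => ih i.1 (by omega) σ hσ
      have ihG := fun σ (hσ : 0 ≤ σ) => ih (m - i.1) (by omega) σ hσ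
      have hQ : ((i.1 + 1 : ℕ) : ℝ) * |R| + ((m - i.1 + 1 : ℕ) : ℝ) * |R| =
          ((m + 2 : ℕ) : ℝ) * |R| := by
        rw [← add_mul, ← Nat.cast_add]
        congr 2
        omega
      have hA0 : 0 ≤ α₁ * γ ^ i.1 * catalan i.1 := by positivity
      have hA'0 : 0 ≤ α₁ * γ ^ (m - i.1) * catalan (m - i.1) := by positivity
      have hB0 : 0 ≤ M₀ * γ ^ i.1 * catalan i.1 := by positivity
      have hmR : 0 ≤ ((m + 2 : ℕ) : ℝ) * |R| := by positivity
      have hsplit : ∀ A X : ℝ, 0 ≤ A → 0 ≤ X →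
          ENNReal.ofReal A * 2 * ENNReal.ofReal X = ENNReal.ofReal (A * 2 * X) := by
        intro A X hA hX
        rw [ENNReal.ofReal_mul (by positivity : 0 ≤ A * 2), ENNReal.ofReal_mul hA,
          ENNReal.ofReal_ofNat]
      refine ⟨?_, fun k => ?_⟩
      · calc ∫⁻ k, ‖duhamelPair (mode v₀ (i.1 + 1)) (mode v₀ (m - i.1 + 1)) s k‖ₑ
            ≤ ENNReal.ofReal (((i.1 + 1 : ℕ) : ℝ) * |R| + ((m - i.1 + 1 : ℕ) : ℝ) * |R|) * 2 *
                ∫⁻ σ in Ioc 0 s, (∫⁻ k, ‖mode v₀ (i.1 + 1) σ k‖ₑ) *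
                  ∫⁻ k', ‖mode v₀ (m - i.1 + 1) σ k'‖ₑ :=
              lintegral_enorm_duhamelPair_le (hmeas _) (hmeas _) (hsupp i.1 s) (hsupp _ s) hst
          _ ≤ ENNReal.ofReal (((m + 2 : ℕ) : ℝ) * |R|) * 2 *
                ∫⁻ σ in Ioc 0 s, ENNReal.ofReal (α₁ * γ ^ i.1 * catalan i.1 * σ ^ i.1) *
                  ENNReal.ofReal (α₁ * γ ^ (m - i.1) * catalan (m - i.1) * σ ^ (m - i.1)) := by
              rw [hQ]
              refine mul_le_mul_right (setLIntegral_mono' measurableSet_Ioc fun σ hσ => ?_) _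
              exact mul_le_mul' (ihF σ hσ.1.le).1 (ihG σ hσ.1.le).1
          _ = ENNReal.ofReal (((m + 2 : ℕ) : ℝ) * |R|) * 2 * ENNReal.ofReal
                (α₁ * γ ^ i.1 * catalan i.1 * (α₁ * γ ^ (m - i.1) * catalan (m - i.1)) *
                  (s ^ (m + 1) / ((m : ℝ) + 1))) := by
              rw [lintegral_Ioc_pow_mul_pow hs hA0 hA'0 (by omega : i.1 + (m - i.1) = m)]
          _ = _ := hsplit _ _ hmR (by positivity)
      · calc ‖duhamelPair (mode v₀ (i.1 + 1)) (mode v₀ (m - i.1 + 1)) s k‖ₑ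
            ≤ ENNReal.ofReal (((i.1 + 1 : ℕ) : ℝ) * |R| + ((m - i.1 + 1 : ℕ) : ℝ) * |R|) * 2 *
                ∫⁻ σ in Ioc 0 s, ENNReal.ofReal (M₀ * γ ^ i.1 * catalan i.1 * σ ^ i.1) *
                  ∫⁻ k', ‖mode v₀ (m - i.1 + 1) σ k'‖ₑ :=
              enorm_duhamelPair_le_sup (hmeas _) (hsupp i.1 s) (hsupp _ s)
                (fun σ hσ k => (ihF σ hσ.1).2 k) hst k
          _ ≤ ENNReal.ofReal (((m + 2 : ℕ) : ℝ) * |R|) * 2 *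
                ∫⁻ σ in Ioc 0 s, ENNReal.ofReal (M₀ * γ ^ i.1 * catalan i.1 * σ ^ i.1) *
                  ENNReal.ofReal (α₁ * γ ^ (m - i.1) * catalan (m - i.1) * σ ^ (m - i.1)) := by
              rw [hQ]
              refine mul_le_mul_right (setLIntegral_mono' measurableSet_Ioc fun σ hσ => ?_) _
              exact mul_le_mul' le_rfl (ihG σ hσ.1.le).1
          _ = ENNReal.ofReal (((m + 2 : ℕ) : ℝ) * |R|) * 2 * ENNReal.ofReal
                (M₀ * γ ^ i.1 * catalan i.1 * (α₁ * γ ^ (m - i.1) * catalan (m - i.1)) *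
                  (s ^ (m + 1) / ((m : ℝ) + 1))) := by
              rw [lintegral_Ioc_pow_mul_pow hs hB0 hA'0 (by omega : i.1 + (m - i.1) = m)]
          _ = _ := hsplit _ _ hmR (by positivity)
    -- summing over the antidiagonal: the Catalan recursion and the ratio `(m+2)/(m+1) ≤ 2`
    have hcat : (catalan (m + 1) : ℝ) =
        ∑ i : Fin (m + 1), (catalan i.1 : ℝ) * catalan (m - i.1) := by
      rw [catalan_succ]
      push_cast
      rfl
    have hγsplit : ∀ i : Fin (m + 1), γ ^ m = γ ^ i.1 * γ ^ (m - i.1) := fun i => by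
      rw [← pow_add, Nat.add_sub_cancel' (Nat.lt_succ_iff.1 i.2)]
    have hmeas_pair : ∀ i : Fin (m + 1), Measurable fun k =>
        ‖duhamelPair (mode v₀ (i.1 + 1)) (mode v₀ (m - i.1 + 1)) s k‖ₑ := fun i =>
      ((measurable_duhamelPair (hmeas _) (hmeas _)).comp
        (measurable_const.prodMk measurable_id)).enorm
    show (∫⁻ k, ‖mode v₀ (m + 2) s k‖ₑ ≤ ENNReal.ofReal (α₁ * γ ^ (m + 1) * catalan (m + 1) *
        s ^ (m + 1))) ∧ ∀ k, ‖mode v₀ (m + 2) s k‖ₑ ≤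
          ENNReal.ofReal (M₀ * γ ^ (m + 1) * catalan (m + 1) * s ^ (m + 1))
    refine ⟨?_, fun k => ?_⟩
    · -- `L¹`
      set K : ℝ := ((m + 2 : ℕ) : ℝ) * |R| * 2 * (α₁ * α₁ * γ ^ m * (s ^ (m + 1) / ((m : ℝ) + 1)))
        with hK
      have hK0 : 0 ≤ K := by positivity
      have hterm : ∀ i : Fin (m + 1), ((m + 2 : ℕ) : ℝ) * |R| * 2 *
          (α₁ * γ ^ i.1 * catalan i.1 * (α₁ * γ ^ (m - i.1) * catalan (m - i.1)) *
            (s ^ (m + 1) / ((m : ℝ) + 1))) = K * ((catalan i.1 : ℝ) * catalan (m - i.1)) := by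
        intro i; rw [hK, hγsplit i]; ring
      calc ∫⁻ k, ‖mode v₀ (m + 2) s k‖ₑ
          = ∫⁻ k, ‖∑ i : Fin (m + 1),
              duhamelPair (mode v₀ (i.1 + 1)) (mode v₀ (m - i.1 + 1)) s k‖ₑ := by
            simp only [mode_add_two]
        _ ≤ ∫⁻ k, ∑ i : Fin (m + 1),
              ‖duhamelPair (mode v₀ (i.1 + 1)) (mode v₀ (m - i.1 + 1)) s k‖ₑ :=
            lintegral_mono fun k => enorm_sum_le _ _
        _ = ∑ i : Fin (m + 1),
              ∫⁻ k, ‖duhamelPair (mode v₀ (i.1 + 1)) (mode v₀ (m - i.1 + 1)) s k‖ₑ :=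
            lintegral_finsetSum _ fun i _ => hmeas_pair i
        _ ≤ ∑ i : Fin (m + 1), ENNReal.ofReal (K * ((catalan i.1 : ℝ) * catalan (m - i.1))) :=
            Finset.sum_le_sum fun i _ => (hterm i) ▸ (hpair i).1
        _ = ENNReal.ofReal (∑ i : Fin (m + 1), K * ((catalan i.1 : ℝ) * catalan (m - i.1))) :=
            (ENNReal.ofReal_sum_of_nonneg fun i _ => by positivity).symm
        _ = ENNReal.ofReal (K * catalan (m + 1)) := by rw [← Finset.mul_sum, hcat]
        _ ≤ ENNReal.ofReal (α₁ * γ ^ (m + 1) * catalan (m + 1) * s ^ (m + 1)) := by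
            refine ENNReal.ofReal_le_ofReal ?_
            set X : ℝ := |R| * (α₁ * α₁ * γ ^ m * s ^ (m + 1) * catalan (m + 1)) with hX
            have hX0 : 0 ≤ X := by positivity
            calc K * catalan (m + 1) = ((m + 2 : ℕ) : ℝ) * 2 * X / ((m : ℝ) + 1) := by
                  rw [hK, hX]; ring
              _ ≤ 4 * X := key_ratio_le m hX0
              _ = α₁ * γ ^ (m + 1) * catalan (m + 1) * s ^ (m + 1) := by
                  rw [hX, pow_succ, hγ]; ring
    · -- sup
      set K : ℝ := ((m + 2 : ℕ) : ℝ) * |R| * 2 * (M₀ * α₁ * γ ^ m * (s ^ (m + 1) / ((m : ℝ) + 1)))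
        with hK
      have hK0 : 0 ≤ K := by positivity
      have hterm : ∀ i : Fin (m + 1), ((m + 2 : ℕ) : ℝ) * |R| * 2 *
          (M₀ * γ ^ i.1 * catalan i.1 * (α₁ * γ ^ (m - i.1) * catalan (m - i.1)) *
            (s ^ (m + 1) / ((m : ℝ) + 1))) = K * ((catalan i.1 : ℝ) * catalan (m - i.1)) := by
        intro i; rw [hK, hγsplit i]; ring
      calc ‖mode v₀ (m + 2) s k‖ₑ
          = ‖∑ i : Fin (m + 1), duhamelPair (mode v₀ (i.1 + 1)) (mode v₀ (m - i.1 + 1)) s k‖ₑ := by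
            rw [mode_add_two]
        _ ≤ ∑ i : Fin (m + 1), ‖duhamelPair (mode v₀ (i.1 + 1)) (mode v₀ (m - i.1 + 1)) s k‖ₑ :=
            enorm_sum_le _ _
        _ ≤ ∑ i : Fin (m + 1), ENNReal.ofReal (K * ((catalan i.1 : ℝ) * catalan (m - i.1))) :=
            Finset.sum_le_sum fun i _ => (hterm i) ▸ (hpair i).2 k
        _ = ENNReal.ofReal (∑ i : Fin (m + 1), K * ((catalan i.1 : ℝ) * catalan (m - i.1))) :=
            (ENNReal.ofReal_sum_of_nonneg fun i _ => by positivity).symm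
        _ = ENNReal.ofReal (K * catalan (m + 1)) := by rw [← Finset.mul_sum, hcat]
        _ ≤ ENNReal.ofReal (M₀ * γ ^ (m + 1) * catalan (m + 1) * s ^ (m + 1)) := by
            refine ENNReal.ofReal_le_ofReal ?_
            set X : ℝ := |R| * (M₀ * α₁ * γ ^ m * s ^ (m + 1) * catalan (m + 1)) with hX
            have hX0 : 0 ≤ X := by positivity
            calc K * catalan (m + 1) = ((m + 2 : ℕ) : ℝ) * 2 * X / ((m : ℝ) + 1) := by
                  rw [hK, hX]; ring
              _ ≤ 4 * X := key_ratio_le m hX0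
              _ = M₀ * γ ^ (m + 1) * catalan (m + 1) * s ^ (m + 1) := by
                  rw [hX, pow_succ, hγ]; ring


/-- `C_n ≤ 4^n` for the Catalan numbers (`(n+1) C_n = binom(2n, n) ≤ 4^n`). [folklore] -/
theorem catalan_le_four_pow (n : ℕ) : catalan n ≤ 4 ^ n :=
  calc catalan n ≤ (n + 1) * catalan n := Nat.le_mul_of_pos_left _ n.succ_pos
    _ = n.centralBinom := succ_mul_catalan_eq_centralBinom n
    _ ≤ 4 ^ n := Nat.centralBinom_le_four_pow n

/-- The geometric majorant of the mode bounds: `X γ^q C_q t^q ≤ X (4 γ t)^q` in `ℝ≥0∞` form.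
[folklore] -/
theorem ofReal_bound_le_geometric {X γ t : ℝ} (hX : 0 ≤ X) (hγ : 0 ≤ γ) (ht : 0 ≤ t) (q : ℕ) :
    ENNReal.ofReal (X * γ ^ q * catalan q * t ^ q) ≤
      ENNReal.ofReal X * ENNReal.ofReal (4 * γ * t) ^ q := by
  rw [← ENNReal.ofReal_pow (by positivity), ← ENNReal.ofReal_mul hX]
  refine ENNReal.ofReal_le_ofReal ?_
  have hc : (catalan q : ℝ) ≤ (4 : ℝ) ^ q := by exact_mod_cast catalan_le_four_pow q
  calc X * γ ^ q * catalan q * t ^ q ≤ X * γ ^ q * (4 : ℝ) ^ q * t ^ q := by gcongr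
    _ = X * (4 * γ * t) ^ q := by ring

/-- **Finite energy for small times** ("the series (3) converges for sufficiently small `s`",
§2 p. 270, for the data class of this file). For a bounded measurable datum vanishing off
`{a ≤ k₃, |k| ≤ R}` with `a > 0` there is `t₀ > 0` such that the series solution has finite
energy `∫ |v(k,t)|² dk < ∞` for all `t ∈ [0, t₀)`: with `γ = 4|R| M₀ vol B(0,R)` one may take
`t₀ = 1/(4γ + 1)`, since `∫ |v|² ≤ ‖v‖_∞ ‖v‖₁` and both norms are dominated by the geometric
series `Σ_q (4γt)^q` (`mode_norm_bounds`, `C_q ≤ 4^q`). The paper quotes this (for its data)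
from [S2]; the proof here is self-contained. [cite: LiSinai2008, §2 p. 270] -/
theorem seriesSolution_energy_lt_top {v₀ : ℝ³ → ℝ³} {a R M₀ : ℝ} (ha : 0 < a)
    (hv₀m : Measurable v₀) (hv₀ : ∀ k, v₀ k ≠ 0 → a ≤ k 2 ∧ ‖k‖ ≤ R) (hM₀ : ∀ k, ‖v₀ k‖ ≤ M₀) :
    ∃ t₀ : ℝ, 0 < t₀ ∧ ∀ t ∈ Ico 0 t₀, ∫⁻ k, ‖seriesSolution v₀ t k‖ₑ ^ 2 < ∞ := by
  have hM₀' : 0 ≤ M₀ := (norm_nonneg _).trans (hM₀ 0)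
  set α₁ : ℝ := M₀ * ballVol R with hα₁
  have hα₁0 : 0 ≤ α₁ := mul_nonneg hM₀' (ballVol_nonneg R)
  set γ : ℝ := 4 * |R| * α₁ with hγ
  have hγ0 : 0 ≤ γ := by positivity
  refine ⟨1 / (4 * γ + 1), by positivity, fun t ht => ?_⟩
  have ht0 : 0 ≤ t := ht.1
  -- the ratio of the geometric majorant is `< 1`
  set r : ℝ≥0∞ := ENNReal.ofReal (4 * γ * t) with hr
  have hr1 : r < 1 := by
    rw [hr, ← ENNReal.ofReal_one]
    refine (ENNReal.ofReal_lt_ofReal_iff zero_lt_one).2 ?_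
    have h1 : t < 1 / (4 * γ + 1) := ht.2
    rw [lt_div_iff₀ (by positivity)] at h1
    nlinarith
  have hgeom : ∑' q : ℕ, r ^ q < ∞ := by
    rw [ENNReal.tsum_geometric, lt_top_iff_ne_top, ENNReal.inv_ne_top]
    exact (tsub_pos_iff_lt.2 hr1).ne'
  have hb := mode_norm_bounds hv₀m hv₀ hM₀
  -- sup bound for the series
  set S : ℝ≥0∞ := ENNReal.ofReal M₀ * ∑' q : ℕ, r ^ q with hS
  have hStop : S < ∞ := ENNReal.mul_lt_top ENNReal.ofReal_lt_top hgeom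
  have hsum_pt : ∀ k, ‖seriesSolution v₀ t k‖ₑ ≤ ∑' p, ‖mode v₀ p t k‖ₑ := by
    intro k
    rw [seriesSolution_eq_sum ha hv₀ (lt_floor_succ_mul ha (k 2)) t]
    exact (enorm_sum_le _ _).trans (ENNReal.sum_le_tsum _)
  have hshift : ∀ k, ∑' p, ‖mode v₀ p t k‖ₑ = ∑' q, ‖mode v₀ (q + 1) t k‖ₑ := by
    intro k
    rw [tsum_eq_zero_add' ENNReal.summable]
    simp [mode_zero]
  have hsup : ∀ k, ‖seriesSolution v₀ t k‖ₑ ≤ S := by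
    intro k
    refine (hsum_pt k).trans ?_
    rw [hshift k, hS, ← ENNReal.tsum_mul_left]
    refine ENNReal.tsum_le_tsum fun q => ((hb q t ht0).2 k).trans ?_
    exact ofReal_bound_le_geometric hM₀' hγ0 ht0 q
  -- `L¹` bound for the series
  set T : ℝ≥0∞ := ENNReal.ofReal α₁ * ∑' q : ℕ, r ^ q with hT
  have hTtop : T < ∞ := ENNReal.mul_lt_top ENNReal.ofReal_lt_top hgeom
  have hL1 : ∫⁻ k, ‖seriesSolution v₀ t k‖ₑ ≤ T := by
    calc ∫⁻ k, ‖seriesSolution v₀ t k‖ₑ ≤ ∫⁻ k, ∑' q, ‖mode v₀ (q + 1) t k‖ₑ :=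
          lintegral_mono fun k => (hsum_pt k).trans_eq (hshift k)
      _ = ∑' q, ∫⁻ k, ‖mode v₀ (q + 1) t k‖ₑ :=
          lintegral_tsum fun q => (measurable_mode_slice hv₀m (q + 1) t).enorm.aemeasurable
      _ ≤ ∑' q : ℕ, ENNReal.ofReal α₁ * r ^ q :=
          ENNReal.tsum_le_tsum fun q => ((hb q t ht0).1).trans
            (ofReal_bound_le_geometric hα₁0 hγ0 ht0 q)
      _ = T := by rw [hT, ENNReal.tsum_mul_left]
  -- energy `≤ ‖v‖_∞ ‖v‖₁`
  calc ∫⁻ k, ‖seriesSolution v₀ t k‖ₑ ^ 2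
      = ∫⁻ k, ‖seriesSolution v₀ t k‖ₑ * ‖seriesSolution v₀ t k‖ₑ := by simp_rw [sq]
    _ ≤ ∫⁻ k, S * ‖seriesSolution v₀ t k‖ₑ := lintegral_mono fun k => mul_le_mul_left (hsup k) _
    _ = S * ∫⁻ k, ‖seriesSolution v₀ t k‖ₑ := lintegral_const_mul' S _ hStop.ne
    _ ≤ S * T := mul_le_mul_right hL1 S
    _ < ∞ := ENNReal.mul_lt_top hStop hTtop


end LiSinai

open LiSinai

/-- **Li–Sinai 2008, infinite energy at the critical time — the first inference of §10 from
Theorem 1.** There exist a real Fourier datum `v₀ : ℝ³ → ℝ³`, measurable, bounded, vanishing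
off `{a ≤ k₃, |k| ≤ R}` with `a > 0` and incompressible (the datum (39) of §7 with the parameter
values `b(t)` of Theorem 1, times the critical amplitude `A_cr(t) = Λ(t)⁻¹`), and a time
`t > 0`, such that the power-series solution `seriesSolution v₀` of (1)
(`LiSinai.seriesSolution_solvesFourierNSAt`) has INFINITE energy at `t`:
`∫ |v(k,t)|² dk = ∞`. In print: "Put `A_cr(t) = Λ(t)⁻¹`. If so then `A^p g_p(k,t)` is
concentrated in the domain with center at `κ⁽⁰⁾p/√t` having the size `O(√p)` and there it takes
values `O(p)`. This immediately implies that at `t` the energy is infinite." This is the part of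
`LiSinaiSeriesEnergyBlowup` that rests on Theorem 1 and one line of §10 only; the finiteness of
the energy on an initial time interval is PROVED for every datum of the class
(`LiSinai.seriesSolution_energy_lt_top`), so this fact already implies the Theorem-1-backed
narrowed form `LiSinaiCriticalEnergyBlowupNarrow` of the audit
(`LiSinaiSeriesEnergyInfinite.criticalEnergyBlowupNarrow`). Not proved here (Theorem 1 is a
renormalisation-group construction with computer-numerical steps, §7 p. 302).
[cite: LiSinai2008, Thm. 1 p. 311 and §10 p. 312 (first paragraph)]

BARRIER (structured block, D-0021):
- technique_class: complexification-insensitive fourier-side-algebra energy-sign-blind real-structure-insensitive formal-perturbation-series power-series-in-data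
- blocks: NavierStokesRegularity (`Literature.NS.NavierStokesExistenceSmoothR3`) by any argument insensitive to the real-valuedness of `u` that would keep the energy of solutions of (1) locally bounded in time: the explicit all-time solution `seriesSolution v₀` has finite energy on `[0, t₀)` (proved, `LiSinai.seriesSolution_energy_lt_top`) and infinite energy at `t` [cite: LiSinai2008, Thm. 1 p. 311 and §10 p. 312]; by `LiSinaiCriticalEnergyBlowupNarrow.literal_or_rightAccumulation` the energy then stops being locally bounded at a finite time.
- because: supports of the modes in `C + ⋯ + C` around `p κ⁽⁰⁾` [cite: LiSinai2008, §2 p. 270]; Gaussian–Hermite renormalisation-group fixed point and `g̃_p = p Z Λ^p e^{-|Y|²/2}(H⁽⁰⁾ + o(1))` for tuned data [cite: LiSinai2008, Thm. 1 p. 311]; at `A = Λ(t)⁻¹` the modes at time `t` have size `O(p)` on balls of size `O(√p)` [cite: LiSinai2008, §10 p. 312].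
- evasions_known: real-valuedness / two-sided spectrum (the data live in `{k₃ ≥ a > 0}`) [cite: LiSinai2008, §1 p. 268–269]; see `ComplexNavierStokesBlowup`.
- scope_caveats: (a) decomposition fact: everything except the divergence of the energy at `t` is proved in this and the previous file; (b) even this first inference is one informal line in print (concentration and size of the modes ⇒ infinite energy, no cancellation between overlapping modes discussed) [cite: LiSinai2008, §10 p. 312]; (c) computer-numerical steps inside the proof of Theorem 1 [cite: LiSinai2008, §7 p. 302]; (d) data class as in `LiSinaiSeriesEnergyBlowup` [cite: LiSinai2008, §7 p. 295]; (e) this fact does NOT give `ComplexNavierStokesBlowup` (finite energy at every `τ < t`): only the narrowed form, cf. the dichotomy `…literal_or_rightAccumulation`.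
- status: established in the sense of the source; not discharged here. -/
def LiSinaiSeriesEnergyInfinite : Prop :=
  ∃ (v₀ : ℝ³ → ℝ³) (a R t : ℝ), 0 < a ∧ 0 < t ∧
    Measurable v₀ ∧ (∃ M : ℝ, ∀ k, ‖v₀ k‖ ≤ M) ∧ (∀ k, v₀ k ≠ 0 → a ≤ k 2 ∧ ‖k‖ ≤ R) ∧
    (∀ k, ⟪v₀ k, k⟫ = 0) ∧
    ∫⁻ k, ‖seriesSolution v₀ t k‖ₑ ^ 2 = ∞

/-- The energy-profile fact trivially contains the infinite-energy fact. [folklore] -/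
theorem LiSinaiSeriesEnergyBlowup.energyInfinite (h : LiSinaiSeriesEnergyBlowup) :
    LiSinaiSeriesEnergyInfinite := by
  obtain ⟨v₀, a, R, t, ha, ht, hm, hM, hsupp, hdiv, -, hinf⟩ := h
  exact ⟨v₀, a, R, t, ha, ht, hm, hM, hsupp, hdiv, hinf⟩

/-- **Infinite energy at one time already gives the narrowed Li–Sinai statement.** From
`LiSinaiSeriesEnergyInfinite` one gets `LiSinaiCriticalEnergyBlowupNarrow`: the series solves
(1) on `[0, t]` (`seriesSolution_solvesFourierNSAt`), its energy is finite on
`[0, min t₀ t)` (`seriesSolution_energy_lt_top`) and infinite at `t`. [folklore] -/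
theorem LiSinaiSeriesEnergyInfinite.criticalEnergyBlowupNarrow (h : LiSinaiSeriesEnergyInfinite) :
    LiSinaiCriticalEnergyBlowupNarrow := by
  obtain ⟨v₀, a, R, t, ha, ht, hm, ⟨M₀, hM₀⟩, hsupp, hdiv, hinf⟩ := h
  obtain ⟨t₀, ht₀, hfin⟩ := seriesSolution_energy_lt_top ha hm hsupp hM₀
  refine ⟨v₀, min t₀ t, t, seriesSolution v₀, lt_min ht₀ ht, min_le_right _ _, hm, ?_, ⟨M₀, hM₀⟩,
    hdiv, seriesSolution_zero v₀, ?_, ?_, ?_, hinf⟩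
  · refine HasCompactSupport.intro (isCompact_closedBall (0 : ℝ³) R) fun k hk => ?_
    by_contra h
    exact hk (mem_closedBall_zero_iff.2 (hsupp k h).2)
  · intro τ hτ k _
    exact seriesSolution_solvesFourierNSAt ha hm hsupp hM₀ hτ.1 k
  · intro τ _
    exact (measurable_seriesSolution ha hm hsupp τ).aemeasurable
  · intro τ hτ
    exact hfin τ ⟨hτ.1, hτ.2.trans_le (min_le_left _ _)⟩

end Literature.Barriers.NavierStokesRegularity
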